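import Summits.AtomisticToContinuum.FouriersLaw.Theorems.BondHeatUncertaintyExtensiveSnapshotIrreversibilityEnergyWindowHarrisResponse

/-!
(SPLIT FOR THE 400-LINE CAP by the landing lane, hand-2 g30: this file = part 1 of 2; sequels `…BondHeatUncertaintyExtensiveSnapshotIrreversibilityEnergyWindowKernelLossLadder` import it in a chain; same namespace, all FQNs unchanged.)
# Crux `ExtensiveSnapshotIrreversibility` (stmt-AtomisticToContinuum-9121): the loss-graded ladder of the kernel leaf S3

Cell decomp-a2c, lens «grading / quantitative ladder», generation 75 (critic rows 1012 (iv), 1022: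
"type (S3♭) ⇒ S3 FIRST as a Lean lemma, so that the analytic leaf is the single-rate
polynomial-loss derivative bound").

HEADLINE.  The kernel leaf S3 `KernelTemperatureLipschitz` of `…EnergyWindowHarrisResponse.lean`
(time-one kernel of the pinned chain `|δ|`-Lipschitz in the bath temperatures from the
`e^{θH}`-weighted sup norm to the `e^{θ'H}`-weighted one, every `0 < θ < θ' < 1/T`) is GRADED BY
THE LOSS PROFILE `ϕ`: the single-rate statement S3[ϕ] `KernelTemperatureLipschitzWithLoss ϕ`,
`|P_{T+δ/2,T−δ/2;1} h(z) − P_{T,T;1} h(z)| ≤ C |δ| ϕ(H(z)) e^{θH(z)}` (`|h| ≤ e^{θH}`, `|δ| < δ₀`,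
every `0 < θ < 1/T`, NO second rate), is the grade-`ϕ` rung, and (all implications PROVED here)

  S3∂ `KernelTemperatureDerivPolyBound` (the Vega DERIVATIVE `∂_ε P^{ε}_1 h(z)` exists on
       `|ε| < δ₀` and is `≤ C (1+H(z))^k e^{θH(z)}`)                    [leaf · ATTACKABLE-L]
   ⟹ S3♭ `KernelTemperatureLipschitzPolyLoss` (= S3[(1+·)^k] for some `k`)  [leaf · ATTACKABLE-L]
   ⟹ S3♮ `KernelTemperatureLipschitzSubexpLoss` (= S3[ϕ] for SOME subexponential `ϕ`, e.g. the
       stretched-exponential grade `e^{c√H}` of the Grönwall heuristic)   [leaf · ATTACKABLE-L]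
   ⟹ S3  `KernelTemperatureLipschitz` (two rates `θ < θ'`)              [g74 leaf]
   ⟺ S3_shell `KernelTemperatureLipschitzOnShell` (S3 asserted ONLY on the energy shell
       `(θ'−θ) H(z) ≤ log(1/|δ|)`; off the shell S3 is AUTOMATIC from CEHR (3.4))  [EQUIV].

So the analytic leaf is the SINGLE-RATE POLYNOMIAL-LOSS bound S3♭ (or its derivative form S3∂,
the literal Malliavin "Vega" target `|∂_ε P^ε_1 h| ≤ C_k (1+H)^k ‖h‖_θ e^{θH}` of the g74 memo):
every subexponential loss is absorbed ONCE AND FOR ALL by the rate slack `e^{(θ'−θ)H}` of S3, and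
S3 ⟺ S3_shell records where S3 has content at all.  Junction of record:
`K_fix ⟸ A0 ∧ A2 ∧ S3♭ ∧ A3p ∧ A4` (`snapshotKLUpperExpansion_of_atoms₅L`; also with S3∂ / S3♮).

GRADES.  `SubexponentialLoss ϕ :⟺ ∀ η > 0 ∃ A ∀ x ≥ 0, |ϕ x| ≤ A e^{ηx}`; proved members: the
polynomial grades `(1+x)^k` (`subexponentialLoss_one_add_pow`), the stretched-exponential grade
`e^{c√x}` (`subexponentialLoss_exp_mul_sqrt`), products and dominated profiles.  Grade
`η`-exponential IS S3.  Calibration point: the HARMONIC chain `lam = β = 0` (outside the typed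
regime; exact Gaussian kernels, `HOME/decomp-a2c-lens-1/g75/numerics/HARMONIC-FALSIFIER.md`) sits at
GRADE 0 — S3[1] holds numerically for `N = 2…5`, `θT ≤ 0.9`, with `sup_z` attained at `z = 0`,
first-order constant `C(θ) ≈ 0.86 / 1.38 / 2.55 / 7.0` at `θT = .3/.5/.7/.9` INDEPENDENT of `θ'−θ`,
and `|δ|`-scaling linear up to `|δ| = 0.2 T` (so neither a `(θ'−θ)^{-k}` blow-up nor a super-linear
`|δ|`-law threatens the leaf).  For the anharmonic chain no grade is in print — conjectured
polynomial, possibly `k = 0` (Norris-lemma moments of the inverse Malliavin matrix polynomial in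
the Lyapunov function, Hairer–Mattingly 2011 §§4–6), fallback stretched-exponential; BOTH suffice
for S3 by this file.

TAGS (D-0171).  S3♭, S3♮, S3∂: WEAKER than the summit (finite-time, fixed-`N` kernel statements:
no steady state, no `N → ∞`, no conductivity; MustFail: none yields `FouriersLaw` by `aesop`),
STRONGER than S3 (honest strengthenings of a leaf, not costumes: `S3 ⊬ S3♭` by `aesop`), leaves
ATTACKABLE-L (Malliavin weight / parametrix / split Duhamel, g74 memo routes (α), (β), (γ)).
S3_shell: EQUIV (proved `iff`; an instrument, not a piece).  Why this is novel: no loss-graded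
temperature-sensitivity statement for the chain's kernels is in print (g74/g75 presearch NULL on
anharmonic chains); the grading separates the one analytic input — a polynomial-moment Malliavin
weight — from the rate bookkeeping, which is discharged here.

References: N. Cuneo, J.-P. Eckmann, M. Hairer, L. Rey-Bellet, EJP 23 (2018) no. 55
(arXiv:1712.09413), §3 eq. (3.4); E. Fournié, J.-M. Lasry, J. Lebuchoux, P.-L. Lions, N. Touzi,
Finance Stoch. 3 (1999) 391–412, Prop. 3.3; M. Hairer, J. C. Mattingly, EJP 16 (2011) 658–738,
§§4–6; V. Konakov, A. Kozhina, S. Menozzi, arXiv:1506.08758, Thm 1–2; J.-P. Eckmann, M. Hairer,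
Comm. Math. Phys. 212 (2000) 105–164, §§3–4 (smoothing estimates for anharmonic chains).
-/

noncomputable section

namespace Summit.AtomisticToContinuum.FouriersLaw.Theorems.ExtensiveSnapshotIrreversibility.EnergyWindow

open MeasureTheory ProbabilityTheory Filter Topology Real
open scoped ENNReal NNReal
open Literature.MathematicalPhysics.KineticTheory.HeatConduction
open Literature.Probability.Process

variable {N : ℕ}

/-! ## 1. Loss profiles: the grades -/

/-- A **subexponential loss profile**: `ϕ` grows slower than every exponential on `[0, ∞)`,
`∀ η > 0, ∃ A, ∀ x ≥ 0, |ϕ x| ≤ A e^{ηx}` (necessarily `A ≥ |ϕ 0| ≥ 0`). [folklore] -/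
def SubexponentialLoss (ϕ : ℝ → ℝ) : Prop :=
  ∀ η : ℝ, 0 < η → ∃ A : ℝ, ∀ x : ℝ, 0 ≤ x → |ϕ x| ≤ A * Real.exp (η * x)

/-- Domination: a profile dominated by a subexponential one is subexponential. [folklore] -/
theorem SubexponentialLoss.of_abs_le {ϕ ψ : ℝ → ℝ} (hϕ : SubexponentialLoss ϕ)
    (hψ : ∀ x, 0 ≤ x → |ψ x| ≤ |ϕ x|) : SubexponentialLoss ψ := fun η hη => by
  obtain ⟨A, hA⟩ := hϕ η hη
  exact ⟨A, fun x hx => (hψ x hx).trans (hA x hx)⟩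

/-- The constant of a subexponential bound is nonnegative. [folklore] -/
theorem SubexponentialLoss.const_nonneg {ϕ : ℝ → ℝ} {η A : ℝ}
    (hA : ∀ x : ℝ, 0 ≤ x → |ϕ x| ≤ A * Real.exp (η * x)) : 0 ≤ A := by
  have h := hA 0 le_rfl
  rw [mul_zero, Real.exp_zero, mul_one] at h
  exact (abs_nonneg _).trans h

/-- Products of subexponential profiles are subexponential (`η = η/2 + η/2`). [folklore] -/
theorem SubexponentialLoss.mul {ϕ ψ : ℝ → ℝ} (hϕ : SubexponentialLoss ϕ)
    (hψ : SubexponentialLoss ψ) : SubexponentialLoss (fun x => ϕ x * ψ x) := fun η hη => by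
  obtain ⟨A, hA⟩ := hϕ (η / 2) (half_pos hη)
  obtain ⟨B, hB⟩ := hψ (η / 2) (half_pos hη)
  have hA0 : 0 ≤ A := SubexponentialLoss.const_nonneg hA
  refine ⟨A * B, fun x hx => ?_⟩
  rw [abs_mul]
  calc |ϕ x| * |ψ x| ≤ (A * Real.exp (η / 2 * x)) * (B * Real.exp (η / 2 * x)) :=
        mul_le_mul (hA x hx) (hB x hx) (abs_nonneg _) (by positivity)
    _ = A * B * Real.exp (η * x) := by
        rw [show η * x = η / 2 * x + η / 2 * x by ring, Real.exp_add]; ring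

/-- **The polynomial grades**: `(1 + x)^k` is subexponential for every `k : ℕ`
(`(η(1+x))^k / k! ≤ e^{η(1+x)}`, Mathlib's `Real.pow_div_factorial_le_exp`). [folklore] -/
theorem subexponentialLoss_one_add_pow (k : ℕ) : SubexponentialLoss (fun x => (1 + x) ^ k) := by
  intro η hη
  refine ⟨k.factorial / η ^ k * Real.exp η, fun x hx => ?_⟩
  have h1 := Real.pow_div_factorial_le_exp (η * (1 + x)) (by positivity) k
  rw [div_le_iff₀ (by positivity), mul_pow] at h1
  have h2 : Real.exp (η * (1 + x)) = Real.exp η * Real.exp (η * x) := by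
    rw [← Real.exp_add]; ring_nf
  show |(1 + x) ^ k| ≤ k.factorial / η ^ k * Real.exp η * Real.exp (η * x)
  rw [abs_of_nonneg (by positivity)]
  have hηk : 0 < η ^ k := by positivity
  calc (1 + x) ^ k = η ^ k * (1 + x) ^ k / η ^ k := by field_simp
    _ ≤ Real.exp (η * (1 + x)) * k.factorial / η ^ k := by gcongr
    _ = k.factorial / η ^ k * Real.exp η * Real.exp (η * x) := by rw [h2]; ring

/-- **The stretched-exponential grade** (exponent `1/2`, the crude Grönwall heuristic for the
anharmonic flow): `e^{c√x}` is subexponential for every `c`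
(`c√x ≤ c²/(4η) + ηx`). [folklore] -/
theorem subexponentialLoss_exp_mul_sqrt (c : ℝ) :
    SubexponentialLoss (fun x => Real.exp (c * Real.sqrt x)) := by
  intro η hη
  refine ⟨Real.exp (c ^ 2 / (4 * η)), fun x hx => ?_⟩
  show |Real.exp (c * Real.sqrt x)| ≤ Real.exp (c ^ 2 / (4 * η)) * Real.exp (η * x)
  rw [Real.abs_exp, ← Real.exp_add, Real.exp_le_exp]
  have hsq : Real.sqrt x ^ 2 = x := Real.sq_sqrt hx
  have h4 : 0 < 4 * η := by positivity
  rw [div_add' _ _ _ h4.ne', le_div_iff₀ h4]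
  have hsq' : 4 * η ^ 2 * Real.sqrt x ^ 2 = 4 * η ^ 2 * x := by rw [hsq]
  nlinarith [sq_nonneg (c - 2 * η * Real.sqrt x), hsq']

/-! ## 2. The loss-graded family `S3[ϕ]` and its `∃`-forms S3♭ (polynomial), S3♮ (subexponential) -/

/-- **S3[ϕ] `KernelTemperatureLipschitzWithLoss ϕ`** (the grade-`ϕ` rung): for positive
parameters, `T > 0`, `N ≥ 2` and EVERY SINGLE rate `0 < θ < 1/T` there are `δ₀ > 0`, `C` with
`|P_{T+δ/2,T−δ/2;1} h(z) − P_{T,T;1} h(z)| ≤ C |δ| ϕ(H(z)) e^{θH(z)}` (`|δ| < δ₀`, all `z`, all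
measurable `|h| ≤ e^{θH}`): Lipschitz at the SAME weight up to the loss `ϕ(H)`.
[cite: FournieLasryLebuchouxLionsTouzi1999, Prop 3.3] [cite: HairerMattingly2011spde, §4–6] -/
def KernelTemperatureLipschitzWithLoss (ϕ : ℝ → ℝ) : Prop :=
  ∀ ω₂ lam β γ : ℝ, 0 < ω₂ → 0 < lam → 0 < β → 0 < γ →
    ∀ T : ℝ, 0 < T → ∀ N : ℕ, 2 ≤ N → ∀ θ : ℝ, 0 < θ → θ < 1 / T →
      ∃ δ₀ C : ℝ, 0 < δ₀ ∧ ∀ δ : ℝ, |δ| < δ₀ →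
        ∀ (z : PhaseSpace N) (h : PhaseSpace N → ℝ), Measurable h →
          (∀ y, |h y| ≤ Real.exp (θ * (pinnedChain ω₂ lam β γ).hamiltonian N y)) →
          |∫ y, h y ∂((pinnedChain ω₂ lam β γ).transitionKernel N (T + δ / 2) (T - δ / 2) 1 z) -
              ∫ y, h y ∂((pinnedChain ω₂ lam β γ).transitionKernel N T T 1 z)| ≤
            C * |δ| * (ϕ ((pinnedChain ω₂ lam β γ).hamiltonian N z) *
              Real.exp (θ * (pinnedChain ω₂ lam β γ).hamiltonian N z))

/-- **S3♭ `KernelTemperatureLipschitzPolyLoss`** (the polynomial-loss leaf — OPEN · ATTACKABLE-L;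
WEAKER than the summit, STRONGER than S3): for every single rate `0 < θ < 1/T` there are
`k : ℕ`, `δ₀ > 0`, `C` with
`|P_{T+δ/2,T−δ/2;1} h(z) − P_{T,T;1} h(z)| ≤ C |δ| (1 + H(z))^k e^{θH(z)}` for `|δ| < δ₀`, all
`z`, all measurable `|h| ≤ e^{θH}` (the expected output of a Malliavin "Vega" weight with
Norris-lemma moments polynomial in `1 + H`). (after FournieLasryLebuchouxLionsTouzi1999, Prop 3.3)
(after HairerMattingly2011spde, §4–6) (after EckmannPilletReyBellet1999a, §3) [route leaf · named hypothesis of this cell, NOT filed as a literature fact] -/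
def KernelTemperatureLipschitzPolyLoss : Prop :=
  ∀ ω₂ lam β γ : ℝ, 0 < ω₂ → 0 < lam → 0 < β → 0 < γ →
    ∀ T : ℝ, 0 < T → ∀ N : ℕ, 2 ≤ N → ∀ θ : ℝ, 0 < θ → θ < 1 / T →
      ∃ (k : ℕ) (δ₀ C : ℝ), 0 < δ₀ ∧ ∀ δ : ℝ, |δ| < δ₀ →
        ∀ (z : PhaseSpace N) (h : PhaseSpace N → ℝ), Measurable h →
          (∀ y, |h y| ≤ Real.exp (θ * (pinnedChain ω₂ lam β γ).hamiltonian N y)) →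
          |∫ y, h y ∂((pinnedChain ω₂ lam β γ).transitionKernel N (T + δ / 2) (T - δ / 2) 1 z) -
              ∫ y, h y ∂((pinnedChain ω₂ lam β γ).transitionKernel N T T 1 z)| ≤
            C * |δ| * ((1 + (pinnedChain ω₂ lam β γ).hamiltonian N z) ^ k *
              Real.exp (θ * (pinnedChain ω₂ lam β γ).hamiltonian N z))

/-- **S3♮ `KernelTemperatureLipschitzSubexpLoss`** (the subexponential-loss rung — OPEN ·
ATTACKABLE-L; between S3♭ and S3): for every single rate `0 < θ < 1/T` there is SOME
subexponential loss profile `ϕ` and `δ₀ > 0`, `C` with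
`|P_{T+δ/2,T−δ/2;1} h(z) − P_{T,T;1} h(z)| ≤ C |δ| ϕ(H(z)) e^{θH(z)}` (`|δ| < δ₀`, all `z`, all
measurable `|h| ≤ e^{θH}`); the fallback grade if the anharmonic flow only allows
stretched-exponential weights.
(after HairerMattingly2011spde, §4–6) (after KonakovKozhinaMenozzi2017, Thm 1–2) [route leaf · named hypothesis of this cell, NOT filed as a literature fact] -/
def KernelTemperatureLipschitzSubexpLoss : Prop :=
  ∀ ω₂ lam β γ : ℝ, 0 < ω₂ → 0 < lam → 0 < β → 0 < γ →
    ∀ T : ℝ, 0 < T → ∀ N : ℕ, 2 ≤ N → ∀ θ : ℝ, 0 < θ → θ < 1 / T →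
      ∃ ϕ : ℝ → ℝ, SubexponentialLoss ϕ ∧ ∃ δ₀ C : ℝ, 0 < δ₀ ∧ ∀ δ : ℝ, |δ| < δ₀ →
        ∀ (z : PhaseSpace N) (h : PhaseSpace N → ℝ), Measurable h →
          (∀ y, |h y| ≤ Real.exp (θ * (pinnedChain ω₂ lam β γ).hamiltonian N y)) →
          |∫ y, h y ∂((pinnedChain ω₂ lam β γ).transitionKernel N (T + δ / 2) (T - δ / 2) 1 z) -
              ∫ y, h y ∂((pinnedChain ω₂ lam β γ).transitionKernel N T T 1 z)| ≤
            C * |δ| * (ϕ ((pinnedChain ω₂ lam β γ).hamiltonian N z) *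
              Real.exp (θ * (pinnedChain ω₂ lam β γ).hamiltonian N z))

/-- `S3[ϕ] ⟹ S3♮` for a subexponential grade `ϕ`. [folklore] -/
theorem kernelTemperatureLipschitzSubexpLoss_of_withLoss {ϕ : ℝ → ℝ} (hϕ : SubexponentialLoss ϕ)
    (h : KernelTemperatureLipschitzWithLoss ϕ) : KernelTemperatureLipschitzSubexpLoss :=
  fun ω₂ lam β γ hω hl hβ hγ T hT N hN θ hθ hθ1 =>
    ⟨ϕ, hϕ, h ω₂ lam β γ hω hl hβ hγ T hT N hN θ hθ hθ1⟩

/-- **S3♭ ⟹ S3♮** (the polynomial grades are subexponential). [folklore] -/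
theorem kernelTemperatureLipschitzSubexpLoss_of_polyLoss (h : KernelTemperatureLipschitzPolyLoss) :
    KernelTemperatureLipschitzSubexpLoss := by
  intro ω₂ lam β γ hω hl hβ hγ T hT N hN θ hθ hθ1
  obtain ⟨k, δ₀, C, hδ₀, hb⟩ := h ω₂ lam β γ hω hl hβ hγ T hT N hN θ hθ hθ1
  exact ⟨fun x => (1 + x) ^ k, subexponentialLoss_one_add_pow k, δ₀, C, hδ₀, hb⟩

/-- ★ **S3♮ ⟹ S3: every subexponential loss is absorbed by the rate slack** — apply S3♮ at
the rate `θ` and bound `|ϕ(H)| ≤ A e^{(θ'−θ)H}` (`H ≥ 0`): `C|δ|ϕ(H)e^{θH} ≤ |C|A|δ|e^{θ'H}`.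
[folklore] -/
theorem kernelTemperatureLipschitz_of_subexpLoss (h : KernelTemperatureLipschitzSubexpLoss) :
    KernelTemperatureLipschitz := by
  intro ω₂ lam β γ hω hl hβ hγ T hT N hN θ θ' hθ hθθ' hθ'1
  obtain ⟨ϕ, hϕ, δ₀, C, hδ₀, hb⟩ := h ω₂ lam β γ hω hl hβ hγ T hT N hN θ hθ (hθθ'.trans hθ'1)
  obtain ⟨A, hA⟩ := hϕ (θ' - θ) (sub_pos.2 hθθ')
  refine ⟨δ₀, |C| * A, hδ₀, fun δ hδ z g hgm hg => ?_⟩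
  set Hz : ℝ := (pinnedChain ω₂ lam β γ).hamiltonian N z with hHz
  have hH0 : 0 ≤ Hz := pinnedChain_hamiltonian_nonneg hω.le hl.le hβ.le γ N z
  have hexp : Real.exp ((θ' - θ) * Hz) * Real.exp (θ * Hz) = Real.exp (θ' * Hz) := by
    rw [← Real.exp_add]; ring_nf
  have h1 := hb δ hδ z g hgm hg
  have h2 : C * |δ| * (ϕ Hz * Real.exp (θ * Hz)) ≤ |C| * |δ| * (|ϕ Hz| * Real.exp (θ * Hz)) := by
    have h := le_abs_self (C * |δ| * (ϕ Hz * Real.exp (θ * Hz)))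
    rwa [abs_mul, abs_mul, abs_mul, abs_abs, Real.abs_exp] at h
  calc |∫ y, g y ∂((pinnedChain ω₂ lam β γ).transitionKernel N (T + δ / 2) (T - δ / 2) 1 z) -
          ∫ y, g y ∂((pinnedChain ω₂ lam β γ).transitionKernel N T T 1 z)|
      ≤ |C| * |δ| * (|ϕ Hz| * Real.exp (θ * Hz)) := h1.trans h2
    _ ≤ |C| * |δ| * (A * Real.exp ((θ' - θ) * Hz) * Real.exp (θ * Hz)) := by
        gcongr
        exact hA Hz hH0
    _ = |C| * A * |δ| * Real.exp (θ' * Hz) := by rw [mul_assoc A, hexp]; ring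

/-- **S3[ϕ] ⟹ S3** for every subexponential grade `ϕ`. [folklore] -/
theorem kernelTemperatureLipschitz_of_withLoss {ϕ : ℝ → ℝ} (hϕ : SubexponentialLoss ϕ)
    (h : KernelTemperatureLipschitzWithLoss ϕ) : KernelTemperatureLipschitz :=
  kernelTemperatureLipschitz_of_subexpLoss (kernelTemperatureLipschitzSubexpLoss_of_withLoss hϕ h)

/-- ★ **S3♭ ⟹ S3** (critic row 1022 (1)). [folklore] -/
theorem kernelTemperatureLipschitz_of_polyLoss (h : KernelTemperatureLipschitzPolyLoss) :
    KernelTemperatureLipschitz :=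
  kernelTemperatureLipschitz_of_subexpLoss (kernelTemperatureLipschitzSubexpLoss_of_polyLoss h)

/-! ## 3. The derivative form S3∂ (the literal Vega target) and S3∂ ⟹ S3♭ -/

/-- **S3∂ `KernelTemperatureDerivPolyBound`** (the Vega-derivative leaf — OPEN · ATTACKABLE-L;
STRONGER than S3♭): for every single rate `0 < θ < 1/T` there are `k : ℕ`, `δ₀ > 0`, `C` such
that for every `z` and every measurable `|h| ≤ e^{θH}` the temperature map
`ε ↦ P_{T+ε/2,T−ε/2;1} h(z)` is DIFFERENTIABLE on `|ε| < δ₀` with derivative bounded by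
`C (1 + H(z))^k e^{θH(z)}` (Malliavin-weight form `∂_ε E[h(z^ε_1)] = E[h(z^ε_1) Θ^ε_1]`,
`‖Θ^ε_1(z)‖_q ≤ C_k (1+H(z))^k`). (after FournieLasryLebuchouxLionsTouzi1999, Prop 3.3)
(after HairerMattingly2011spde, §4–6) (after ArnaudonThalmaier2010, Thm 2.1–2.2) [route leaf · named hypothesis of this cell, NOT filed as a literature fact] -/
def KernelTemperatureDerivPolyBound : Prop :=
  ∀ ω₂ lam β γ : ℝ, 0 < ω₂ → 0 < lam → 0 < β → 0 < γ →
    ∀ T : ℝ, 0 < T → ∀ N : ℕ, 2 ≤ N → ∀ θ : ℝ, 0 < θ → θ < 1 / T →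
      ∃ (k : ℕ) (δ₀ C : ℝ), 0 < δ₀ ∧
        ∀ (z : PhaseSpace N) (h : PhaseSpace N → ℝ), Measurable h →
          (∀ y, |h y| ≤ Real.exp (θ * (pinnedChain ω₂ lam β γ).hamiltonian N y)) →
          ∃ D : ℝ → ℝ, ∀ ε : ℝ, |ε| < δ₀ →
            HasDerivAt (fun ε' : ℝ =>
                ∫ y, h y ∂((pinnedChain ω₂ lam β γ).transitionKernel N
                  (T + ε' / 2) (T - ε' / 2) 1 z)) (D ε) ε ∧
              |D ε| ≤ C * ((1 + (pinnedChain ω₂ lam β γ).hamiltonian N z) ^ k *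
                Real.exp (θ * (pinnedChain ω₂ lam β γ).hamiltonian N z))

/-- **S3∂ ⟹ S3♭** by the mean value inequality on `(−δ₀, δ₀)`. [folklore] -/
theorem kernelTemperatureLipschitzPolyLoss_of_derivPolyBound
    (h : KernelTemperatureDerivPolyBound) : KernelTemperatureLipschitzPolyLoss := by
  intro ω₂ lam β γ hω hl hβ hγ T hT N hN θ hθ hθ1
  obtain ⟨k, δ₀, C, hδ₀, hD⟩ := h ω₂ lam β γ hω hl hβ hγ T hT N hN θ hθ hθ1
  refine ⟨k, δ₀, C, hδ₀, fun δ hδ z g hgm hg => ?_⟩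
  obtain ⟨D, hD'⟩ := hD z g hgm hg
  set Hz : ℝ := (pinnedChain ω₂ lam β γ).hamiltonian N z with hHz
  set F : ℝ → ℝ := fun ε' =>
    ∫ y, g y ∂((pinnedChain ω₂ lam β γ).transitionKernel N (T + ε' / 2) (T - ε' / 2) 1 z) with hF
  have h0 : (0 : ℝ) ∈ Set.Ioo (-δ₀) δ₀ := ⟨by linarith, hδ₀⟩
  have hδ' : δ ∈ Set.Ioo (-δ₀) δ₀ := abs_lt.1 hδ
  have hmvt : ‖F δ - F 0‖ ≤ C * ((1 + Hz) ^ k * Real.exp (θ * Hz)) * ‖δ - 0‖ :=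
    (convex_Ioo (-δ₀) δ₀).norm_image_sub_le_of_norm_hasDerivWithin_le
      (fun ε hε => (hD' ε (abs_lt.2 hε)).1.hasDerivWithinAt)
      (fun ε hε => by rw [Real.norm_eq_abs]; exact (hD' ε (abs_lt.2 hε)).2) h0 hδ'
  rw [Real.norm_eq_abs, Real.norm_eq_abs, sub_zero] at hmvt
  have hF0 : F 0 = ∫ y, g y ∂((pinnedChain ω₂ lam β γ).transitionKernel N T T 1 z) := by
    simp only [hF, zero_div, add_zero, sub_zero]
  rw [hF0] at hmvt
  calc |∫ y, g y ∂((pinnedChain ω₂ lam β γ).transitionKernel N (T + δ / 2) (T - δ / 2) 1 z) -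
          ∫ y, g y ∂((pinnedChain ω₂ lam β γ).transitionKernel N T T 1 z)|
      ≤ C * ((1 + Hz) ^ k * Real.exp (θ * Hz)) * |δ| := hmvt
    _ = C * |δ| * ((1 + Hz) ^ k * Real.exp (θ * Hz)) := by ring

/-- **S3∂ ⟹ S3.** [folklore] -/
theorem kernelTemperatureLipschitz_of_derivPolyBound (h : KernelTemperatureDerivPolyBound) :
    KernelTemperatureLipschitz :=
  kernelTemperatureLipschitz_of_polyLoss (kernelTemperatureLipschitzPolyLoss_of_derivPolyBound h)

end Summit.AtomisticToContinuum.FouriersLaw.Theorems.ExtensiveSnapshotIrreversibility.EnergyWindow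

end
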